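import Summits.AtomisticToContinuum.Crystallization.Theses.SquareWellLayerCake
import Literature.Geometry.DiscreteGeometry.KissingRigidity

/-!
# Disproof work file — crux `SquareWellLayerCake.GapTwelveToBarlow` (stmt-AtomisticToContinuum-15807)

Standing disprover (cdisprove), cycle 1.  Findings (see the docstrings):

* §0 `gapTwelveToBarlow_iff` — normal form `∀ x, GS x → (¬Good-fraction → 0) → ∀ R ε, (¬Matched-fraction → 0)`.
* §1 `norm_sq_pairSum`, `pairSum_dichotomy` — LATTICE OF DIFFERENCES of a Barlow template: for stacking
  points `p, p', z`, the vector `p + p' − 2z` is either `0` or has squared norm `≥ min (a²/3) h²`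
  (`> 1/12` on the crux's parameter box `a, h > 1/2`).
* §2 `not_matched_of_short_pairSum` — OBSTRUCTION: a site with two `R`-neighbours `j, k` whose offsets sum to
  a vector of norm in `(2ε, 1/(2√3) − 2ε)` is never `(R, ε)`-Barlow-matched (any `a h s z A`).
* §3–§6 the energy-free reading is FALSE: `gapTwelveToBarlow_false_without_isGroundState` — witness: fcc whose
  (100) layer gaps alternate `7/10, 33/50` (bonds `0.967 / 0.995 / 1`, all Good in the bulk), unmatched at
  `(R, ε) = (1, 1/100)` at EVERY bulk site by §2 (pair sum `(±1/25, 0, 0)`).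
* §7 `not_matched_of_short_combination` — the obstruction for arbitrary INTEGER combinations of neighbour offsets.
* §8 `good_deca`, `not_matched_deca`, `exists_good_not_matched` — the D₅ₕ decahedral-axis cluster (exact kissing
  up to rounding, integer coordinates /1005): its centre is Good yet not `(1, ε)`-matched for any `ε ≤ 1/500`
  (golden-ratio combination `−3(u₀+ℓ₀)+5(u₁+ℓ₁+u₄+ℓ₄)` of norm `164/1005`): Good ⇏ Matched POINTWISE, so K3 is
  an essentially global/energetic statement and five-fold centres must be shown sparse in minimisers.

LANDED (tree, `--supports 15807`): `Theorems/GapTwelveToBarlow/Negative/PairSumObstruction.lean` (p129417),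
`…/WitnessLattice.lean` (p129555), `…/FiveFoldShell.lean` (p129761), `…/WithoutGroundState.lean` (p129913) — all
ACCEPTED 2026-08-16; import those modules rather than this work file.  WHY THE CRUX ITSELF RESISTS: it is an implication between two unverified asymptotic properties of
EXACT Lennard-Jones ground states; no finite computation or printed structure theorem reaches actual minimisers;
dropping the Good hypothesis instead gives `LaminarBarlowWindows` (open item 14292); every weakening of Good keeps a
statement about minimisers.  What a prover must supply: minimality ⇒ (i) no bond/gap alternation above `2ε` at
a.e. site (strain-free to precision ε at R = 1), (ii) five-fold centres of density → 0, (iii) gap uniformity at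
cubic-context layers (no positive density of relaxed inequivalent-gap polytypes/faults).
-/

noncomputable section

open scoped BigOperators
open Filter Topology

namespace Summit.AtomisticToContinuum.Crystallization.Cruxes.GapTwelveToBarlow.Disproof

open Literature.MathematicalPhysics.StatisticalMechanics Literature.Geometry.DiscreteGeometry
open Summit.AtomisticToContinuum.Crystallization.Theses.SquareWellLayerCake

local notation "E3" => EuclideanSpace ℝ (Fin 3)

/-! ## §0 The crux's predicates, named verbatim -/

/-- The hypothesis predicate of the crux at site `i` (verbatim): the `11/10`-neighbourhood is
`55/57`-separated, exactly twelve others within `1`, at most twelve within `11/10`. -/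
def Good {N : ℕ} (x : Fin N → E3) (i : Fin N) : Prop :=
  (∀ j : Fin N, dist (x i) (x j) ≤ 11 / 10 → ∀ k : Fin N, k ≠ j → (55 : ℝ) / 57 ≤ dist (x j) (x k)) ∧
  (Finset.univ.filter fun j : Fin N => j ≠ i ∧ dist (x i) (x j) ≤ 1).card = 12 ∧
  (Finset.univ.filter fun j : Fin N => j ≠ i ∧ dist (x i) (x j) ≤ 11 / 10).card ≤ 12

/-- The conclusion predicate of the crux at site `i` (verbatim): the `R`-window is two-way `ε`-matched,
after a linear isometry, to a window of some Barlow stacking `barlowStacking a h s`. -/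
def Matched {N : ℕ} (R ε : ℝ) (x : Fin N → E3) (i : Fin N) : Prop :=
  ∃ a h : ℝ, 1 / 2 < a ∧ a < 2 ∧ 1 / 2 < h ∧ h < 2 ∧ ∃ s : ℤ → ℤ, IsHaggSeq s ∧
    ∃ z ∈ barlowStacking a h s, ∃ A : E3 →ₗᵢ[ℝ] E3,
      (∀ p ∈ barlowStacking a h s, dist p z ≤ R → ∃ j : Fin N, dist (x j) (x i + A (p - z)) ≤ ε) ∧
      (∀ j : Fin N, dist (x j) (x i) ≤ R → ∃ p ∈ barlowStacking a h s, dist (x j) (x i + A (p - z)) ≤ ε)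

/-- NORMAL FORM: the crux is `∀ x, (ground states) → (¬Good-fraction → 0) → ∀ R ε, (¬Matched-fraction → 0)`,
definitionally. -/
theorem gapTwelveToBarlow_iff :
    GapTwelveToBarlow ↔ ∀ x : (N : ℕ) → (Fin N → E3), (∀ N, IsGroundState lennardJones (x N)) →
      Tendsto (fun N : ℕ => (Nat.card {i : Fin N // ¬ Good (x N) i} : ℝ) / N) atTop (𝓝 0) →
      ∀ R ε : ℝ, 0 < R → 0 < ε → ε < 1 / 4 →
        Tendsto (fun N : ℕ => (Nat.card {i : Fin N // ¬ Matched R ε (x N) i} : ℝ) / N) atTop (𝓝 0) :=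
  Iff.rfl

/-- The crux with the ground-state hypothesis `∀ N, IsGroundState lennardJones (x N)` DELETED
(the "energy-free reading": gap-twelve geometry alone would force Barlow windows). -/
def GapTwelveToBarlowWithoutIsGroundState : Prop :=
  ∀ x : (N : ℕ) → (Fin N → E3),
      Tendsto (fun N : ℕ => (Nat.card {i : Fin N // ¬ Good (x N) i} : ℝ) / N) atTop (𝓝 0) →
      ∀ R ε : ℝ, 0 < R → 0 < ε → ε < 1 / 4 →
        Tendsto (fun N : ℕ => (Nat.card {i : Fin N // ¬ Matched R ε (x N) i} : ℝ) / N) atTop (𝓝 0)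

/-! ## §1 The lattice of differences of a Barlow template -/

/-- Coordinates of `p + p' − 2 z` for three template points. [folklore] -/
theorem pairSum_apply (a h : ℝ) (s : ℤ → ℤ) (k₁ i₁ j₁ k₂ i₂ j₂ k₀ i₀ j₀ : ℤ) :
    let v := barlowPos a h s k₁ i₁ j₁ + barlowPos a h s k₂ i₂ j₂ - (2 : ℝ) • barlowPos a h s k₀ i₀ j₀
    v 0 = a / 2 * ((2 * (i₁ + i₂ - 2 * i₀) + (j₁ + j₂ - 2 * j₀) +
            (haggLabel s k₁ + haggLabel s k₂ - 2 * haggLabel s k₀) : ℤ) : ℝ) ∧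
    v 1 = a * √3 / 6 * ((3 * (j₁ + j₂ - 2 * j₀) +
            (haggLabel s k₁ + haggLabel s k₂ - 2 * haggLabel s k₀) : ℤ) : ℝ) ∧
    v 2 = ((k₁ + k₂ - 2 * k₀ : ℤ) : ℝ) * h := by
  refine ⟨?_, ?_, ?_⟩
  · simp only [PiLp.sub_apply, PiLp.add_apply, PiLp.smul_apply, barlowPos_apply_zero, smul_eq_mul]
    push_cast; ring
  · simp only [PiLp.sub_apply, PiLp.add_apply, PiLp.smul_apply, barlowPos_apply_one, smul_eq_mul]
    push_cast; ring
  · simp only [PiLp.sub_apply, PiLp.add_apply, PiLp.smul_apply, barlowPos_apply_two, smul_eq_mul]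
    push_cast; ring

/-- For integers of equal parity, not both zero, `3 P² + Q² ≥ 4`. [folklore] -/
theorem four_le_of_parity {P Q : ℤ} (hpar : Even (P - Q)) (hne : ¬ (P = 0 ∧ Q = 0)) :
    4 ≤ 3 * P ^ 2 + Q ^ 2 := by
  obtain ⟨t, ht⟩ := hpar
  have sq1 : ∀ n : ℤ, n ≠ 0 → 1 ≤ n ^ 2 := fun n hn => by
    rcases lt_trichotomy n 0 with h | h | h
    · nlinarith
    · exact absurd h hn
    · nlinarith
  by_cases hQ : Q = 0
  · have hP : P ≠ 0 := fun hP => hne ⟨hP, hQ⟩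
    have htne : t ≠ 0 := by rintro rfl; apply hP; omega
    have hPt : P = 2 * t := by omega
    have := sq1 t htne
    rw [hPt, hQ]; nlinarith
  · have hQ1 := sq1 Q hQ
    by_cases hP : P = 0
    · have hQt : Q = -(2 * t) := by omega
      have htne : t ≠ 0 := by rintro rfl; apply hQ; omega
      have := sq1 t htne
      rw [hP, hQt]; nlinarith
    · have := sq1 P hP
      nlinarith

/-- **Lattice of differences.** For any three points `p, p', z` of a Barlow template the vector
`p + p' − 2z` lies in the lattice `Λ*(a) ⊕ h ℤ e₃` (`Λ*` triangular of spacing `a/√3`): it is either `0`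
or has squared norm at least `min (a²/3) h²`.  No hypothesis on `a, h, s`. [folklore] -/
theorem pairSum_dichotomy (a h : ℝ) (s : ℤ → ℤ) (k₁ i₁ j₁ k₂ i₂ j₂ k₀ i₀ j₀ : ℤ) :
    barlowPos a h s k₁ i₁ j₁ + barlowPos a h s k₂ i₂ j₂ - (2 : ℝ) • barlowPos a h s k₀ i₀ j₀ = 0 ∨
    min (a ^ 2 / 3) (h ^ 2) ≤
      ‖barlowPos a h s k₁ i₁ j₁ + barlowPos a h s k₂ i₂ j₂ - (2 : ℝ) • barlowPos a h s k₀ i₀ j₀‖ ^ 2 := by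
  obtain ⟨h0, h1, h2⟩ := pairSum_apply a h s k₁ i₁ j₁ k₂ i₂ j₂ k₀ i₀ j₀
  set v := barlowPos a h s k₁ i₁ j₁ + barlowPos a h s k₂ i₂ j₂ - (2 : ℝ) • barlowPos a h s k₀ i₀ j₀
    with hv
  set P : ℤ := 2 * (i₁ + i₂ - 2 * i₀) + (j₁ + j₂ - 2 * j₀) +
    (haggLabel s k₁ + haggLabel s k₂ - 2 * haggLabel s k₀) with hP
  set Q : ℤ := 3 * (j₁ + j₂ - 2 * j₀) + (haggLabel s k₁ + haggLabel s k₂ - 2 * haggLabel s k₀) with hQ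
  set K : ℤ := k₁ + k₂ - 2 * k₀ with hK
  have h3 : (√3 : ℝ) ^ 2 = 3 := Real.sq_sqrt (by norm_num)
  have hnorm : ‖v‖ ^ 2 = a ^ 2 / 12 * (3 * (P : ℝ) ^ 2 + (Q : ℝ) ^ 2) + (K : ℝ) ^ 2 * h ^ 2 := by
    rw [EuclideanSpace.norm_eq, Real.sq_sqrt (Finset.sum_nonneg fun _ _ => by positivity),
      Fin.sum_univ_three, Real.norm_eq_abs, Real.norm_eq_abs, Real.norm_eq_abs, sq_abs, sq_abs, sq_abs,
      h0, h1, h2]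
    linear_combination (a ^ 2 / 36 * (Q : ℝ) ^ 2) * h3
  by_cases hK0 : K = 0
  · by_cases hPQ : P = 0 ∧ Q = 0
    · left
      ext l
      fin_cases l
      · simpa [hPQ.1] using h0
      · simpa [hPQ.2] using h1
      · simpa [hK0] using h2
    · right
      have hpar : Even (P - Q) := ⟨(i₁ + i₂ - 2 * i₀) - (j₁ + j₂ - 2 * j₀), by simp only [hP, hQ]; ring⟩
      have h4 : (4 : ℝ) ≤ 3 * (P : ℝ) ^ 2 + (Q : ℝ) ^ 2 := by exact_mod_cast four_le_of_parity hpar hPQ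
      calc min (a ^ 2 / 3) (h ^ 2) ≤ a ^ 2 / 3 := min_le_left _ _
        _ ≤ a ^ 2 / 12 * (3 * (P : ℝ) ^ 2 + (Q : ℝ) ^ 2) + (K : ℝ) ^ 2 * h ^ 2 := by
            nlinarith [sq_nonneg a, sq_nonneg ((K : ℝ) * h)]
        _ = ‖v‖ ^ 2 := hnorm.symm
  · right
    have hK1 : (1 : ℝ) ≤ (K : ℝ) ^ 2 := by
      have : (1 : ℤ) ≤ K ^ 2 := by
        rcases lt_trichotomy K 0 with hk | hk | hk
        · nlinarith
        · exact absurd hk hK0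
        · nlinarith
      exact_mod_cast this
    calc min (a ^ 2 / 3) (h ^ 2) ≤ h ^ 2 := min_le_right _ _
      _ ≤ a ^ 2 / 12 * (3 * (P : ℝ) ^ 2 + (Q : ℝ) ^ 2) + (K : ℝ) ^ 2 * h ^ 2 := by
          nlinarith [sq_nonneg a, sq_nonneg h, sq_nonneg (P : ℝ), sq_nonneg (Q : ℝ)]
      _ = ‖v‖ ^ 2 := hnorm.symm

/-! ## §2 The obstruction: short non-zero pair sums are never matched -/

/-- **Pair-sum obstruction (boundary lemma for the conclusion predicate).** If site `i` has two
`R`-neighbours `j, k` with `2ε < ‖(x j − x i) + (x k − x i)‖` and `(‖(x j − x i) + (x k − x i)‖ + 2ε)² < 1/12`,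
then `i` is NOT `(R, ε)`-matched to any Barlow template with `a, h > 1/2` (whatever `s`, `z`, `A`):
the two matched template points `p, p'` would give a lattice vector `p + p' − 2z` of norm in
`(0, 1/(2√3))`, excluded by `pairSum_dichotomy`.  In words: Barlow windows are centrosymmetric modulo the
lattice `Λ*(a) ⊕ hℤe₃` to precision `2ε`. [folklore] -/
theorem not_matched_of_short_pairSum {N : ℕ} {x : Fin N → E3} {i j k : Fin N} {R ε : ℝ}
    (hjR : dist (x j) (x i) ≤ R) (hkR : dist (x k) (x i) ≤ R)
    (hlow : 2 * ε < ‖(x j - x i) + (x k - x i)‖)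
    (hup : (‖(x j - x i) + (x k - x i)‖ + 2 * ε) ^ 2 < 1 / 12) :
    ¬ Matched R ε x i := by
  rintro ⟨a, h, ha, -, hh, -, s, -, z, hz, A, -, h2⟩
  obtain ⟨p, hp, hpj⟩ := h2 j hjR
  obtain ⟨p', hp', hpk⟩ := h2 k hkR
  obtain ⟨k₀, i₀, j₀, rfl⟩ := hz
  obtain ⟨k₁, i₁, j₁, rfl⟩ := hp
  obtain ⟨k₂, i₂, j₂, rfl⟩ := hp'
  set z := barlowPos a h s k₀ i₀ j₀ with hzdef
  set p := barlowPos a h s k₁ i₁ j₁ with hpdef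
  set p' := barlowPos a h s k₂ i₂ j₂ with hp'def
  set w := (x j - x i) + (x k - x i) with hw
  have hv : A (p - z) + A (p' - z) = A (p + p' - (2 : ℝ) • z) := by
    rw [← map_add]; congr 1; module
  rw [dist_eq_norm] at hpj hpk
  have e1 : x j - (x i + A (p - z)) = (x j - x i) - A (p - z) := by abel
  have e2 : x k - (x i + A (p' - z)) = (x k - x i) - A (p' - z) := by abel
  rw [e1] at hpj
  rw [e2] at hpk
  have htri : ‖w - A (p + p' - (2 : ℝ) • z)‖ ≤ 2 * ε := by
    calc ‖w - A (p + p' - (2 : ℝ) • z)‖ = ‖((x j - x i) - A (p - z)) + ((x k - x i) - A (p' - z))‖ := by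
          rw [← hv, hw]; congr 1; abel
      _ ≤ ‖(x j - x i) - A (p - z)‖ + ‖(x k - x i) - A (p' - z)‖ := norm_add_le _ _
      _ ≤ 2 * ε := by linarith
  have hAv : ‖A (p + p' - (2 : ℝ) • z)‖ = ‖p + p' - (2 : ℝ) • z‖ := A.norm_map _
  have hlow' : ‖w‖ - 2 * ε ≤ ‖p + p' - (2 : ℝ) • z‖ := by
    have := norm_sub_norm_le w (A (p + p' - (2 : ℝ) • z))
    linarith
  have hup' : ‖p + p' - (2 : ℝ) • z‖ ≤ ‖w‖ + 2 * ε := by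
    have := norm_sub_norm_le (A (p + p' - (2 : ℝ) • z)) w
    rw [norm_sub_rev] at this
    linarith
  rcases pairSum_dichotomy a h s k₁ i₁ j₁ k₂ i₂ j₂ k₀ i₀ j₀ with h0 | hmin
  · have h0' : p + p' - (2 : ℝ) • z = 0 := h0
    have : ‖p + p' - (2 : ℝ) • z‖ = 0 := by rw [h0', norm_zero]
    linarith
  · have hmin' : (1 : ℝ) / 12 < min (a ^ 2 / 3) (h ^ 2) := by
      rw [lt_min_iff]; constructor <;> nlinarith
    have hnn : 0 ≤ ‖p + p' - (2 : ℝ) • z‖ := norm_nonneg _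
    have hsq : ‖p + p' - (2 : ℝ) • z‖ ^ 2 ≤ (‖w‖ + 2 * ε) ^ 2 := by
      have hε : 0 ≤ ‖w‖ + 2 * ε := le_trans hnn hup'
      nlinarith
    have : min (a ^ 2 / 3) (h ^ 2) ≤ ‖p + p' - (2 : ℝ) • z‖ ^ 2 := hmin
    linarith

/-- **Gap-jump corollary (template adequacy).**  If site `i` has `R`-neighbours `j` (above) and `k`
(below) with offsets `ω + g₁ e` and `−ω − g₂ e` for a unit vector `e` — a cubic-context layer between layer
gaps `g₁` (up) and `g₂` (down) — then `i` is unmatched as soon as `2ε < |g₁ − g₂|` and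
`(|g₁ − g₂| + 2ε)² < 1/12`: the conclusion's template `barlowStacking a h s` has ONE gap `h`, so K3 as typed
asserts a.e. gap uniformity to precision `2ε` at every cubic-context layer (relaxed 6H/9R-type polytypes,
twin and fault neighbourhoods have `g₁ ≠ g₂`). [folklore] -/
theorem not_matched_of_gap_jump {N : ℕ} {x : Fin N → E3} {i j k : Fin N} {R ε g₁ g₂ : ℝ} {ω e : E3}
    (he : ‖e‖ = 1) (hjR : dist (x j) (x i) ≤ R) (hkR : dist (x k) (x i) ≤ R)
    (hj : x j - x i = ω + g₁ • e) (hk : x k - x i = -ω - g₂ • e)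
    (hlow : 2 * ε < |g₁ - g₂|) (hup : (|g₁ - g₂| + 2 * ε) ^ 2 < 1 / 12) :
    ¬ Matched R ε x i := by
  have hsum : (x j - x i) + (x k - x i) = (g₁ - g₂) • e := by rw [hj, hk]; module
  have hnorm : ‖(x j - x i) + (x k - x i)‖ = |g₁ - g₂| := by
    rw [hsum, norm_smul, he, mul_one, Real.norm_eq_abs]
  exact not_matched_of_short_pairSum hjR hkR (hnorm ▸ hlow) (hnorm ▸ hup)

/-! ## §3 The witness lattice: unit square layers, gaps alternating `7/10` and `33/50`

Site labels are integer triples `(ℓ, p, q)`; layer `ℓ` is the unit square lattice `(p, q)` shifted by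
`(1/2, 1/2)` when `ℓ` is odd, placed at height `Z ℓ = (17/25) ℓ + (1/50)(ℓ % 2)` along the FIRST axis.
This is the fcc lattice in its (100) description (nearest-neighbour distance `1`, ideal gap `1/√2`) with
the gaps replaced by `7/10` (above even layers) and `33/50` (above odd layers): bond lengths
`1` (in-layer), `√(99/100)`, `√(2339/2500) ≈ 0.9672 ≥ 55/57 ≈ 0.9649`; second distances `≥ 1.36 > 11/10`. -/

/-- Position of the site labelled `u = (ℓ, p, q)`. -/
def pos (u : ℤ × ℤ × ℤ) : E3 :=
  !₂[(17 : ℝ) / 25 * (u.1 : ℝ) + 1 / 50 * ((u.1 % 2 : ℤ) : ℝ),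
     (u.2.1 : ℝ) + ((u.1 % 2 : ℤ) : ℝ) / 2,
     (u.2.2 : ℝ) + ((u.1 % 2 : ℤ) : ℝ) / 2]

@[simp] theorem pos_apply_zero (u : ℤ × ℤ × ℤ) :
    pos u 0 = (17 : ℝ) / 25 * (u.1 : ℝ) + 1 / 50 * ((u.1 % 2 : ℤ) : ℝ) := rfl

@[simp] theorem pos_apply_one (u : ℤ × ℤ × ℤ) : pos u 1 = (u.2.1 : ℝ) + ((u.1 % 2 : ℤ) : ℝ) / 2 := rfl

@[simp] theorem pos_apply_two (u : ℤ × ℤ × ℤ) : pos u 2 = (u.2.2 : ℝ) + ((u.1 % 2 : ℤ) : ℝ) / 2 := rfl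

/-- Squared distance of two sites in terms of the label differences and the parity jump
`e = ℓ' % 2 − ℓ % 2`. -/
theorem dist_pos_sq (ℓ p q ℓ' p' q' : ℤ) :
    dist (pos (ℓ', p', q')) (pos (ℓ, p, q)) ^ 2 =
      ((17 : ℝ) / 25 * ((ℓ' - ℓ : ℤ) : ℝ) + 1 / 50 * ((ℓ' % 2 - ℓ % 2 : ℤ) : ℝ)) ^ 2 +
      (((p' - p : ℤ) : ℝ) + ((ℓ' % 2 - ℓ % 2 : ℤ) : ℝ) / 2) ^ 2 +
      (((q' - q : ℤ) : ℝ) + ((ℓ' % 2 - ℓ % 2 : ℤ) : ℝ) / 2) ^ 2 := by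
  rw [EuclideanSpace.dist_eq, Real.sq_sqrt (Finset.sum_nonneg fun _ _ => by positivity),
    Fin.sum_univ_three, Real.dist_eq, Real.dist_eq, Real.dist_eq, sq_abs, sq_abs, sq_abs,
    pos_apply_zero, pos_apply_one, pos_apply_two, pos_apply_zero, pos_apply_one, pos_apply_two]
  push_cast
  ring

/-- An integer with square `< 4` lies in `{-1, 0, 1}`. [folklore] -/
theorem abs_le_one_of_sq_lt_four {n : ℤ} (hn : n ^ 2 < 4) : -1 ≤ n ∧ n ≤ 1 := by
  constructor <;> nlinarith

/-- **Uniform discreteness of the witness**: distinct sites are at squared distance `≥ 2339/2500`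
(`= (33/50)² + 1/2`, attained by the short interlayer bonds). -/
theorem le_dist_pos_sq {ℓ p q ℓ' p' q' : ℤ} (hne : (ℓ', p', q') ≠ (ℓ, p, q)) :
    (2339 : ℝ) / 2500 ≤ dist (pos (ℓ', p', q')) (pos (ℓ, p, q)) ^ 2 := by
  rw [dist_pos_sq]
  set D : ℤ := ℓ' - ℓ with hD
  set e : ℤ := ℓ' % 2 - ℓ % 2 with he
  set m : ℤ := p' - p with hm
  set n : ℤ := q' - q with hn
  have hcase : (D = 0 ∧ e = 0) ∨ ((D = 1 ∨ D = -1) ∧ (e = 1 ∨ e = -1)) ∨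
      ((2 ≤ D ∨ D ≤ -2) ∧ (-1 ≤ e ∧ e ≤ 1)) := by omega
  rcases hcase with ⟨hD0, he0⟩ | ⟨hD1, he1⟩ | ⟨hD2, he2⟩
  · -- same layer: an integer vector of the square lattice
    have hmn : m ≠ 0 ∨ n ≠ 0 := by
      by_contra hmn
      push Not at hmn
      apply hne
      simp only [Prod.mk.injEq]
      omega
    have h1 : (1 : ℝ) ≤ (m : ℝ) ^ 2 + (n : ℝ) ^ 2 := by
      rcases hmn with h | h
      · have := ((one_le_sq_iff_one_le_abs _).2 (Int.one_le_abs h))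
        have : (1 : ℝ) ≤ (m : ℝ) ^ 2 := by exact_mod_cast this
        nlinarith [sq_nonneg (n : ℝ)]
      · have := ((one_le_sq_iff_one_le_abs _).2 (Int.one_le_abs h))
        have : (1 : ℝ) ≤ (n : ℝ) ^ 2 := by exact_mod_cast this
        nlinarith [sq_nonneg (m : ℝ)]
    rw [hD0, he0]
    push_cast
    nlinarith
  · -- adjacent layers: |Δ₀| ≥ 33/50 and the lateral offsets are half-odd integers
    have hodd1 : (1 : ℝ) ≤ ((2 * m + e : ℤ) : ℝ) ^ 2 := by
      exact_mod_cast ((one_le_sq_iff_one_le_abs _).2 (Int.one_le_abs (show 2 * m + e ≠ 0 by omega)))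
    have hodd2 : (1 : ℝ) ≤ ((2 * n + e : ℤ) : ℝ) ^ 2 := by
      exact_mod_cast ((one_le_sq_iff_one_le_abs _).2 (Int.one_le_abs (show 2 * n + e ≠ 0 by omega)))
    push_cast at hodd1 hodd2
    have h0 : (1089 : ℝ) / 2500 ≤ ((17 : ℝ) / 25 * (D : ℝ) + 1 / 50 * (e : ℝ)) ^ 2 := by
      rcases hD1 with h | h <;> rcases he1 with h' | h' <;> rw [h, h'] <;> norm_num
    nlinarith
  · -- two or more layers apart: |Δ₀| ≥ 67/50
    have hD' : (2 : ℝ) ≤ (D : ℝ) ∨ (D : ℝ) ≤ -2 := by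
      rcases hD2 with h | h
      · left; exact_mod_cast h
      · right; exact_mod_cast h
    have he' : (-1 : ℝ) ≤ (e : ℝ) ∧ (e : ℝ) ≤ 1 := ⟨by exact_mod_cast he2.1, by exact_mod_cast he2.2⟩
    have h0 : (4489 : ℝ) / 2500 ≤ ((17 : ℝ) / 25 * (D : ℝ) + 1 / 50 * (e : ℝ)) ^ 2 := by
      rcases hD' with h | h
      · have : (67 : ℝ) / 50 ≤ (17 : ℝ) / 25 * (D : ℝ) + 1 / 50 * (e : ℝ) := by linarith
        nlinarith
      · have : (17 : ℝ) / 25 * (D : ℝ) + 1 / 50 * (e : ℝ) ≤ -(67 / 50) := by linarith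
        nlinarith
    nlinarith [sq_nonneg ((m : ℝ) + (e : ℝ) / 2), sq_nonneg ((n : ℝ) + (e : ℝ) / 2)]

/-- Distinct sites are `≥ 55/57` apart (`(55/57)² = 3025/3249 < 2339/2500`). -/
theorem le_dist_pos {u u' : ℤ × ℤ × ℤ} (hne : u' ≠ u) : (55 : ℝ) / 57 ≤ dist (pos u') (pos u) := by
  obtain ⟨ℓ, p, q⟩ := u
  obtain ⟨ℓ', p', q'⟩ := u'
  have h := le_dist_pos_sq hne
  have hd : 0 ≤ dist (pos (ℓ', p', q')) (pos (ℓ, p, q)) := dist_nonneg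
  nlinarith

/-- The twelve neighbour labels of `u = (ℓ, p, q)` (`r = ℓ % 2`): four in the layer, four above, four below. -/
def nbrOff (r : ℤ) : Fin 12 → ℤ × ℤ × ℤ :=
  ![(0, 1, 0), (0, -1, 0), (0, 0, 1), (0, 0, -1),
    (1, r, r), (1, r - 1, r), (1, r, r - 1), (1, r - 1, r - 1),
    (-1, r, r), (-1, r - 1, r), (-1, r, r - 1), (-1, r - 1, r - 1)]

/-- The `t`-th neighbour label of `u`. -/
def nbr (u : ℤ × ℤ × ℤ) (t : Fin 12) : ℤ × ℤ × ℤ :=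
  (u.1 + (nbrOff (u.1 % 2) t).1, u.2.1 + (nbrOff (u.1 % 2) t).2.1, u.2.2 + (nbrOff (u.1 % 2) t).2.2)

/-- The neighbour labels are pairwise distinct. -/
theorem nbr_injective (u : ℤ × ℤ × ℤ) : Function.Injective (nbr u) := by
  intro t t' h
  simp only [nbr, Prod.mk.injEq] at h
  obtain ⟨h1, h2, h3⟩ := h
  fin_cases t <;> fin_cases t' <;> simp [nbrOff] at h1 h2 h3 ⊢ <;> omega

/-- A neighbour label differs from the centre. -/
theorem nbr_ne (u : ℤ × ℤ × ℤ) (t : Fin 12) : nbr u t ≠ u := by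
  obtain ⟨ℓ, p, q⟩ := u
  intro h
  simp only [nbr, Prod.mk.injEq] at h
  obtain ⟨h1, h2, h3⟩ := h
  fin_cases t <;> simp [nbrOff] at h1 h2 h3

/-- **The twelve neighbours are within distance `1`** (squared distances `1`, `99/100`, `2339/2500`). -/
theorem dist_nbr_sq_le (u : ℤ × ℤ × ℤ) (t : Fin 12) : dist (pos (nbr u t)) (pos u) ^ 2 ≤ 1 := by
  obtain ⟨ℓ, p, q⟩ := u
  have key : ∀ d m n : ℤ, dist (pos (ℓ + d, p + m, q + n)) (pos (ℓ, p, q)) ^ 2 =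
      ((17 : ℝ) / 25 * (d : ℝ) + 1 / 50 * (((ℓ + d) % 2 - ℓ % 2 : ℤ) : ℝ)) ^ 2 +
      ((m : ℝ) + (((ℓ + d) % 2 - ℓ % 2 : ℤ) : ℝ) / 2) ^ 2 +
      ((n : ℝ) + (((ℓ + d) % 2 - ℓ % 2 : ℤ) : ℝ) / 2) ^ 2 := by
    intro d m n
    rw [dist_pos_sq]
    push_cast
    ring
  have hr : ℓ % 2 = 0 ∨ ℓ % 2 = 1 := by omega
  have e0 : (ℓ + 0) % 2 - ℓ % 2 = 0 := by omega
  have eup : (ℓ + 1) % 2 - ℓ % 2 = 1 - 2 * (ℓ % 2) := by omega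
  have edn : (ℓ + -1) % 2 - ℓ % 2 = 1 - 2 * (ℓ % 2) := by omega
  fin_cases t
  · show dist (pos (ℓ + 0, p + 1, q + 0)) (pos (ℓ, p, q)) ^ 2 ≤ 1
    rw [key, e0]; push_cast; norm_num
  · show dist (pos (ℓ + 0, p + -1, q + 0)) (pos (ℓ, p, q)) ^ 2 ≤ 1
    rw [key, e0]; push_cast; norm_num
  · show dist (pos (ℓ + 0, p + 0, q + 1)) (pos (ℓ, p, q)) ^ 2 ≤ 1
    rw [key, e0]; push_cast; norm_num
  · show dist (pos (ℓ + 0, p + 0, q + -1)) (pos (ℓ, p, q)) ^ 2 ≤ 1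
    rw [key, e0]; push_cast; norm_num
  · show dist (pos (ℓ + 1, p + ℓ % 2, q + ℓ % 2)) (pos (ℓ, p, q)) ^ 2 ≤ 1
    rw [key, eup]; rcases hr with h | h <;> rw [h] <;> push_cast <;> norm_num
  · show dist (pos (ℓ + 1, p + (ℓ % 2 - 1), q + ℓ % 2)) (pos (ℓ, p, q)) ^ 2 ≤ 1
    rw [key, eup]; rcases hr with h | h <;> rw [h] <;> push_cast <;> norm_num
  · show dist (pos (ℓ + 1, p + ℓ % 2, q + (ℓ % 2 - 1))) (pos (ℓ, p, q)) ^ 2 ≤ 1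
    rw [key, eup]; rcases hr with h | h <;> rw [h] <;> push_cast <;> norm_num
  · show dist (pos (ℓ + 1, p + (ℓ % 2 - 1), q + (ℓ % 2 - 1))) (pos (ℓ, p, q)) ^ 2 ≤ 1
    rw [key, eup]; rcases hr with h | h <;> rw [h] <;> push_cast <;> norm_num
  · show dist (pos (ℓ + -1, p + ℓ % 2, q + ℓ % 2)) (pos (ℓ, p, q)) ^ 2 ≤ 1
    rw [key, edn]; rcases hr with h | h <;> rw [h] <;> push_cast <;> norm_num
  · show dist (pos (ℓ + -1, p + (ℓ % 2 - 1), q + ℓ % 2)) (pos (ℓ, p, q)) ^ 2 ≤ 1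
    rw [key, edn]; rcases hr with h | h <;> rw [h] <;> push_cast <;> norm_num
  · show dist (pos (ℓ + -1, p + ℓ % 2, q + (ℓ % 2 - 1))) (pos (ℓ, p, q)) ^ 2 ≤ 1
    rw [key, edn]; rcases hr with h | h <;> rw [h] <;> push_cast <;> norm_num
  · show dist (pos (ℓ + -1, p + (ℓ % 2 - 1), q + (ℓ % 2 - 1))) (pos (ℓ, p, q)) ^ 2 ≤ 1
    rw [key, edn]; rcases hr with h | h <;> rw [h] <;> push_cast <;> norm_num

/-- The twelve neighbours are within distance `1`. -/
theorem dist_nbr_le (u : ℤ × ℤ × ℤ) (t : Fin 12) : dist (pos (nbr u t)) (pos u) ≤ 1 := by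
  have h := dist_nbr_sq_le u t
  have hd : 0 ≤ dist (pos (nbr u t)) (pos u) := dist_nonneg
  nlinarith

/-- **Classification of the `11/10`-neighbourhood**: a site at squared distance `≤ 121/100` from `u` is
`u` itself or one of its twelve neighbours. -/
theorem eq_nbr_of_dist_sq_le {u u' : ℤ × ℤ × ℤ} (hne : u' ≠ u)
    (hd : dist (pos u') (pos u) ^ 2 ≤ 121 / 100) : ∃ t : Fin 12, u' = nbr u t := by
  obtain ⟨ℓ, p, q⟩ := u
  obtain ⟨ℓ', p', q'⟩ := u'
  rw [dist_pos_sq] at hd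
  set D : ℤ := ℓ' - ℓ with hD
  set e : ℤ := ℓ' % 2 - ℓ % 2 with he
  set m : ℤ := p' - p with hm
  set n : ℤ := q' - q with hn
  set r : ℤ := ℓ % 2 with hr
  have hcase : (D = 0 ∧ e = 0) ∨ ((D = 1 ∨ D = -1) ∧ e = 1 - 2 * r ∧ (r = 0 ∨ r = 1)) ∨
      ((2 ≤ D ∨ D ≤ -2) ∧ (-1 ≤ e ∧ e ≤ 1)) := by omega
  rcases hcase with ⟨hD0, he0⟩ | ⟨hD1, he1, hr1⟩ | ⟨hD2, he2⟩
  · -- same layer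
    rw [hD0, he0] at hd
    push_cast at hd
    have hm2 : m ^ 2 < 4 := by
      by_contra h4
      push Not at h4
      have : (4 : ℝ) ≤ (m : ℝ) ^ 2 := by exact_mod_cast h4
      nlinarith [sq_nonneg (n : ℝ)]
    have hn2 : n ^ 2 < 4 := by
      by_contra h4
      push Not at h4
      have : (4 : ℝ) ≤ (n : ℝ) ^ 2 := by exact_mod_cast h4
      nlinarith [sq_nonneg (m : ℝ)]
    have hm1 := abs_le_one_of_sq_lt_four hm2
    have hn1 := abs_le_one_of_sq_lt_four hn2
    have hmn : ¬ (m ≠ 0 ∧ n ≠ 0) := by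
      rintro ⟨h1, h2⟩
      have a1 : (1 : ℝ) ≤ (m : ℝ) ^ 2 := by exact_mod_cast ((one_le_sq_iff_one_le_abs _).2 (Int.one_le_abs h1))
      have a2 : (1 : ℝ) ≤ (n : ℝ) ^ 2 := by exact_mod_cast ((one_le_sq_iff_one_le_abs _).2 (Int.one_le_abs h2))
      nlinarith
    have hmn0 : ¬ (m = 0 ∧ n = 0) := by
      rintro ⟨h1, h2⟩
      apply hne
      simp only [Prod.mk.injEq]
      omega
    have h4 : (m = 1 ∧ n = 0) ∨ (m = -1 ∧ n = 0) ∨ (m = 0 ∧ n = 1) ∨ (m = 0 ∧ n = -1) := by omega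
    rcases h4 with ⟨h1, h2⟩ | ⟨h1, h2⟩ | ⟨h1, h2⟩ | ⟨h1, h2⟩
    · exact ⟨0, by simp only [nbr, nbrOff, Prod.mk.injEq]; simp; omega⟩
    · exact ⟨1, by simp only [nbr, nbrOff, Prod.mk.injEq]; simp; omega⟩
    · exact ⟨2, by simp only [nbr, nbrOff, Prod.mk.injEq]; simp; omega⟩
    · exact ⟨3, by simp only [nbr, nbrOff, Prod.mk.injEq]; simp; omega⟩
  · -- adjacent layers
    have h0 : (1089 : ℝ) / 2500 ≤ ((17 : ℝ) / 25 * (D : ℝ) + 1 / 50 * (e : ℝ)) ^ 2 := by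
      have he1' : e = 1 ∨ e = -1 := by omega
      rcases hD1 with h | h <;> rcases he1' with h' | h' <;> rw [h, h'] <;> norm_num
    have hm4 : (2 * m + e) ^ 2 < 4 := by
      by_contra h4
      push Not at h4
      have : (4 : ℝ) ≤ ((2 * m + e : ℤ) : ℝ) ^ 2 := by exact_mod_cast h4
      push_cast at this
      nlinarith [sq_nonneg ((n : ℝ) + (e : ℝ) / 2)]
    have hn4 : (2 * n + e) ^ 2 < 4 := by
      by_contra h4
      push Not at h4
      have : (4 : ℝ) ≤ ((2 * n + e : ℤ) : ℝ) ^ 2 := by exact_mod_cast h4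
      push_cast at this
      nlinarith [sq_nonneg ((m : ℝ) + (e : ℝ) / 2)]
    have hm1 := abs_le_one_of_sq_lt_four hm4
    have hn1 := abs_le_one_of_sq_lt_four hn4
    have hm' : m = r ∨ m = r - 1 := by omega
    have hn' : n = r ∨ n = r - 1 := by omega
    rcases hD1 with hDv | hDv <;> rcases hm' with hmv | hmv <;> rcases hn' with hnv | hnv
    · exact ⟨4, by simp only [nbr, nbrOff, Prod.mk.injEq]; simp; omega⟩
    · exact ⟨6, by simp only [nbr, nbrOff, Prod.mk.injEq]; simp; omega⟩
    · exact ⟨5, by simp only [nbr, nbrOff, Prod.mk.injEq]; simp; omega⟩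
    · exact ⟨7, by simp only [nbr, nbrOff, Prod.mk.injEq]; simp; omega⟩
    · exact ⟨8, by simp only [nbr, nbrOff, Prod.mk.injEq]; simp; omega⟩
    · exact ⟨10, by simp only [nbr, nbrOff, Prod.mk.injEq]; simp; omega⟩
    · exact ⟨9, by simp only [nbr, nbrOff, Prod.mk.injEq]; simp; omega⟩
    · exact ⟨11, by simp only [nbr, nbrOff, Prod.mk.injEq]; simp; omega⟩
  · -- far layers: impossible
    exfalso
    have hD' : (2 : ℝ) ≤ (D : ℝ) ∨ (D : ℝ) ≤ -2 := by
      rcases hD2 with h | h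
      · left; exact_mod_cast h
      · right; exact_mod_cast h
    have he' : (-1 : ℝ) ≤ (e : ℝ) ∧ (e : ℝ) ≤ 1 := ⟨by exact_mod_cast he2.1, by exact_mod_cast he2.2⟩
    have h0 : (4489 : ℝ) / 2500 ≤ ((17 : ℝ) / 25 * (D : ℝ) + 1 / 50 * (e : ℝ)) ^ 2 := by
      rcases hD' with h | h
      · have : (67 : ℝ) / 50 ≤ (17 : ℝ) / 25 * (D : ℝ) + 1 / 50 * (e : ℝ) := by linarith
        nlinarith
      · have : (17 : ℝ) / 25 * (D : ℝ) + 1 / 50 * (e : ℝ) ≤ -(67 / 50) := by linarith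
        nlinarith
    nlinarith [sq_nonneg ((m : ℝ) + (e : ℝ) / 2), sq_nonneg ((n : ℝ) + (e : ℝ) / 2)]

/-- **The pair-sum defect of the witness**: the neighbour above `(1, r, r)` and the neighbour below
`(-1, r-1, r-1)` have offsets summing to `(±1/25, 0, 0)` — norm `1/25`. -/
theorem norm_pairSum_nbr (u : ℤ × ℤ × ℤ) :
    ‖(pos (nbr u 4) - pos u) + (pos (nbr u 11) - pos u)‖ = 1 / 25 := by
  obtain ⟨ℓ, p, q⟩ := u
  have hr : ℓ % 2 = 0 ∨ ℓ % 2 = 1 := by omega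
  have hup : (ℓ + 1) % 2 = 1 - ℓ % 2 := by omega
  have hdn : (ℓ + -1) % 2 = 1 - ℓ % 2 := by omega
  have hsq : ‖(pos (nbr (ℓ, p, q) 4) - pos (ℓ, p, q)) + (pos (nbr (ℓ, p, q) 11) - pos (ℓ, p, q))‖ ^ 2
      = (1 / 25) ^ 2 := by
    rw [EuclideanSpace.norm_eq, Real.sq_sqrt (Finset.sum_nonneg fun _ _ => by positivity),
      Fin.sum_univ_three, Real.norm_eq_abs, Real.norm_eq_abs, Real.norm_eq_abs, sq_abs, sq_abs, sq_abs]
    simp only [PiLp.add_apply, PiLp.sub_apply, pos_apply_zero, pos_apply_one, pos_apply_two, nbr, nbrOff,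
      Fin.isValue, Matrix.cons_val, hup, hdn]
    rcases hr with h | h <;> simp only [h] <;> push_cast <;> ring
  have hnn : 0 ≤ ‖(pos (nbr (ℓ, p, q) 4) - pos (ℓ, p, q)) + (pos (nbr (ℓ, p, q) 11) - pos (ℓ, p, q))‖ :=
    norm_nonneg _
  nlinarith

/-! ## §4 The witness configurations: a box of the lattice plus far-away spare particles -/

/-- Labels of the box of side `n`: layers `0 ≤ ℓ < 2n`, columns `0 ≤ p, q < n` (`2n³` sites). -/
def boxIdx (n : ℕ) : Finset (ℤ × ℤ × ℤ) :=
  (Finset.Ico (0 : ℤ) (2 * n)) ×ˢ ((Finset.Ico (0 : ℤ) n) ×ˢ (Finset.Ico (0 : ℤ) n))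

/-- Labels of the interior of the box: `1 ≤ ℓ ≤ 2n − 2`, `1 ≤ p, q ≤ n − 2`. -/
def interiorIdx (n : ℕ) : Finset (ℤ × ℤ × ℤ) :=
  (Finset.Ico (1 : ℤ) (2 * n - 1)) ×ˢ ((Finset.Ico (1 : ℤ) (n - 1)) ×ˢ (Finset.Ico (1 : ℤ) (n - 1)))

theorem mem_boxIdx {n : ℕ} {u : ℤ × ℤ × ℤ} :
    u ∈ boxIdx n ↔ (0 ≤ u.1 ∧ u.1 < 2 * n) ∧ (0 ≤ u.2.1 ∧ u.2.1 < n) ∧ (0 ≤ u.2.2 ∧ u.2.2 < n) := by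
  simp only [boxIdx, Finset.mem_product, Finset.mem_Ico]

theorem mem_interiorIdx {n : ℕ} {u : ℤ × ℤ × ℤ} :
    u ∈ interiorIdx n ↔
      (1 ≤ u.1 ∧ u.1 < 2 * n - 1) ∧ (1 ≤ u.2.1 ∧ u.2.1 < n - 1) ∧ (1 ≤ u.2.2 ∧ u.2.2 < n - 1) := by
  simp only [interiorIdx, Finset.mem_product, Finset.mem_Ico]

theorem card_boxIdx (n : ℕ) : (boxIdx n).card = 2 * n ^ 3 := by
  simp only [boxIdx, Finset.card_product, Int.card_Ico, sub_zero]
  have h1 : ((2 : ℤ) * n).toNat = 2 * n := by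
    rw [show ((2 : ℤ) * n) = ((2 * n : ℕ) : ℤ) by push_cast; ring, Int.toNat_natCast]
  rw [h1, Int.toNat_natCast]
  ring

theorem card_interiorIdx {n : ℕ} (hn : 2 ≤ n) : (interiorIdx n).card = (2 * n - 2) * (n - 2) ^ 2 := by
  simp only [interiorIdx, Finset.card_product, Int.card_Ico]
  have h1 : ((2 : ℤ) * n - 1 - 1).toNat = 2 * n - 2 := by
    rw [show ((2 : ℤ) * n - 1 - 1) = ((2 * n - 2 : ℕ) : ℤ) by push_cast [show 2 ≤ 2 * n by omega]; ring,
      Int.toNat_natCast]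
  have h2 : ((n : ℤ) - 1 - 1).toNat = n - 2 := by
    rw [show ((n : ℤ) - 1 - 1) = ((n - 2 : ℕ) : ℤ) by push_cast [hn]; ring, Int.toNat_natCast]
  rw [h1, h2]
  ring

theorem interiorIdx_subset (n : ℕ) : interiorIdx n ⊆ boxIdx n := by
  intro u hu
  rw [mem_interiorIdx] at hu
  rw [mem_boxIdx]
  omega

theorem nbr_mem_boxIdx {n : ℕ} {u : ℤ × ℤ × ℤ} (hu : u ∈ interiorIdx n) (t : Fin 12) :
    nbr u t ∈ boxIdx n := by
  obtain ⟨ℓ, p, q⟩ := u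
  simp only [mem_interiorIdx] at hu
  obtain ⟨⟨h1, h2⟩, ⟨h3, h4⟩, ⟨h5, h6⟩⟩ := hu
  rw [mem_boxIdx]
  have hr : 0 ≤ ℓ % 2 ∧ ℓ % 2 ≤ 1 := by omega
  fin_cases t <;> simp [nbr, nbrOff] <;> omega

/-- The side of the box used for `N` particles: the largest `n` with `2n³ ≤ N`. -/
def side (N : ℕ) : ℕ := Nat.findGreatest (fun n => 2 * n ^ 3 ≤ N) N

theorem two_mul_side_pow_le (N : ℕ) : 2 * side N ^ 3 ≤ N :=
  Nat.findGreatest_spec (P := fun n => 2 * n ^ 3 ≤ N) (Nat.zero_le N) (by simp)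

theorem le_side {N m : ℕ} (h : 2 * m ^ 3 ≤ N) : m ≤ side N := by
  refine Nat.le_findGreatest ?_ h
  calc m ≤ m ^ 3 := Nat.le_self_pow (by norm_num) m
    _ ≤ 2 * m ^ 3 := by omega
    _ ≤ N := h

theorem lt_two_mul_side_succ_pow (N : ℕ) : N < 2 * (side N + 1) ^ 3 := by
  by_contra hN
  push Not at hN
  have := le_side hN
  omega

theorem side_tendsto_atTop : Tendsto side atTop atTop := by
  refine tendsto_atTop_atTop.2 fun K => ⟨2 * K ^ 3, fun N hN => le_side hN⟩

theorem card_boxIdx_side_le (N : ℕ) : (boxIdx (side N)).card ≤ N := by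
  rw [card_boxIdx]; exact two_mul_side_pow_le N

/-- Spare particles, far away on the negative first axis and `1` apart from each other. -/
def junk (i : ℕ) : E3 := !₂[-(5 : ℝ) - i, 0, 0]

@[simp] theorem junk_apply_zero (i : ℕ) : junk i 0 = -(5 : ℝ) - i := rfl

/-- **THE WITNESS SEQUENCE.**  For `N` particles: the box of side `side N` of the lattice of §3
(`2 (side N)³` sites, enumerated by `Finset.equivFin`), the remaining `N − 2 (side N)³ = O(N^{2/3})`
particles parked far away. -/
def witness (N : ℕ) : Fin N → E3 := fun i =>
  if hi : (i : ℕ) < (boxIdx (side N)).card then pos ((boxIdx (side N)).equivFin.symm ⟨i, hi⟩).1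
  else junk i

/-- The index in `Fin N` of the box site labelled `u`. -/
def idx (N : ℕ) (u : ℤ × ℤ × ℤ) (hu : u ∈ boxIdx (side N)) : Fin N :=
  ⟨((boxIdx (side N)).equivFin ⟨u, hu⟩ : ℕ),
    lt_of_lt_of_le (Fin.is_lt _) (card_boxIdx_side_le N)⟩

@[simp] theorem witness_idx (N : ℕ) (u : ℤ × ℤ × ℤ) (hu : u ∈ boxIdx (side N)) :
    witness N (idx N u hu) = pos u := by
  unfold witness idx
  simp only [Fin.is_lt, ↓reduceDIte, Fin.eta, Equiv.symm_apply_apply]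

theorem idx_injective {N : ℕ} {u v : ℤ × ℤ × ℤ} (hu : u ∈ boxIdx (side N)) (hv : v ∈ boxIdx (side N))
    (h : idx N u hu = idx N v hv) : u = v := by
  unfold idx at h
  simp only [Fin.mk.injEq] at h
  have := (boxIdx (side N)).equivFin.injective (Fin.ext h)
  simpa using this

/-- A particle whose index is below the box count sits at the position of its label. -/
theorem witness_of_lt {N : ℕ} (j : Fin N) (hj : (j : ℕ) < (boxIdx (side N)).card) :
    ∃ (u : ℤ × ℤ × ℤ) (hu : u ∈ boxIdx (side N)), idx N u hu = j ∧ witness N j = pos u := by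
  refine ⟨((boxIdx (side N)).equivFin.symm ⟨j, hj⟩).1, ((boxIdx (side N)).equivFin.symm ⟨j, hj⟩).2,
    ?_, ?_⟩
  · unfold idx
    ext
    simp only [Subtype.coe_eta, Equiv.apply_symm_apply]
  · unfold witness
    simp only [hj, ↓reduceDIte]

/-- A particle beyond the box count is a spare. -/
theorem witness_of_le {N : ℕ} (j : Fin N) (hj : (boxIdx (side N)).card ≤ (j : ℕ)) :
    witness N j = junk j := by
  unfold witness
  simp only [not_lt.2 hj, ↓reduceDIte]

/-- Box sites have non-negative first coordinate. -/
theorem pos_apply_zero_nonneg {n : ℕ} {u : ℤ × ℤ × ℤ} (hu : u ∈ boxIdx n) : 0 ≤ pos u 0 := by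
  rw [mem_boxIdx] at hu
  rw [pos_apply_zero]
  have h1 : (0 : ℝ) ≤ (u.1 : ℝ) := by exact_mod_cast hu.1.1
  have h2 : (0 : ℝ) ≤ ((u.1 % 2 : ℤ) : ℝ) := by exact_mod_cast (Int.emod_nonneg u.1 two_ne_zero)
  positivity

/-- Spares are at distance `≥ 5` from every box site. -/
theorem five_le_dist_junk_pos {n : ℕ} {u : ℤ × ℤ × ℤ} (hu : u ∈ boxIdx n) (i : ℕ) :
    (5 : ℝ) ≤ dist (junk i) (pos u) := by
  refine le_trans ?_ (PiLp.dist_apply_le (junk i) (pos u) 0)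
  rw [junk_apply_zero, Real.dist_eq]
  have := pos_apply_zero_nonneg hu
  have hi : (0 : ℝ) ≤ i := Nat.cast_nonneg i
  rw [abs_of_nonpos (by linarith)]
  linarith

/-- **Separation**: every box particle is `55/57`-separated from every other particle. -/
theorem sep_witness {N : ℕ} {j k : Fin N} (hjk : k ≠ j) (hj : (j : ℕ) < (boxIdx (side N)).card) :
    (55 : ℝ) / 57 ≤ dist (witness N j) (witness N k) := by
  obtain ⟨u, hu, rfl, hju⟩ := witness_of_lt j hj
  rw [hju]
  by_cases hk : (k : ℕ) < (boxIdx (side N)).card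
  · obtain ⟨v, hv, rfl, hkv⟩ := witness_of_lt k hk
    rw [hkv, dist_comm]
    refine le_dist_pos ?_
    rintro rfl
    exact hjk rfl
  · rw [witness_of_le k (not_lt.1 hk), dist_comm]
    exact le_trans (by norm_num) (five_le_dist_junk_pos hu k)

/-- A particle within `11/10` of a box particle is a box particle. -/
theorem lt_card_of_dist_le {N : ℕ} {u : ℤ × ℤ × ℤ} (hu : u ∈ boxIdx (side N)) {k : Fin N}
    (hk : dist (pos u) (witness N k) ≤ 11 / 10) : (k : ℕ) < (boxIdx (side N)).card := by
  by_contra hk'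
  rw [witness_of_le k (not_lt.1 hk'), dist_comm] at hk
  have := five_le_dist_junk_pos hu k
  linarith

/-- **Every interior box particle is Good** for the crux's hypothesis predicate. -/
theorem good_witness {N : ℕ} {u : ℤ × ℤ × ℤ} (hu : u ∈ interiorIdx (side N)) :
    Good (witness N) (idx N u (interiorIdx_subset _ hu)) := by
  classical
  have hub : u ∈ boxIdx (side N) := interiorIdx_subset _ hu
  set i : Fin N := idx N u hub with hi
  have hxi : witness N i = pos u := witness_idx N u hub
  refine ⟨?_, ?_⟩
  · -- separation of the 11/10-neighbourhood
    intro j hj k hkj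
    rw [hxi] at hj
    exact sep_witness hkj (lt_card_of_dist_le hub hj)
  · -- the counts: I = image of the twelve neighbours
    set I : Finset (Fin N) := Finset.univ.image fun t : Fin 12 => idx N (nbr u t) (nbr_mem_boxIdx hu t)
      with hI
    set S := Finset.univ.filter fun j : Fin N => j ≠ i ∧ dist (witness N i) (witness N j) ≤ 1 with hS
    set T := Finset.univ.filter fun j : Fin N => j ≠ i ∧ dist (witness N i) (witness N j) ≤ 11 / 10
      with hT
    have hIcard : I.card = 12 := by
      rw [hI, Finset.card_image_of_injective _ ?_, Finset.card_univ, Fintype.card_fin]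
      intro t t' htt
      exact nbr_injective u (idx_injective _ _ htt)
    have hIS : I ⊆ S := by
      intro j hj
      rw [hI, Finset.mem_image] at hj
      obtain ⟨t, -, rfl⟩ := hj
      rw [hS, Finset.mem_filter]
      refine ⟨Finset.mem_univ _, ?_, ?_⟩
      · intro h
        exact nbr_ne u t (idx_injective _ _ h)
      · rw [hxi, witness_idx, dist_comm]
        exact dist_nbr_le u t
    have hST : S ⊆ T := by
      intro j hj
      rw [hS, Finset.mem_filter] at hj
      rw [hT, Finset.mem_filter]
      exact ⟨hj.1, hj.2.1, hj.2.2.trans (by norm_num)⟩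
    have hTI : T ⊆ I := by
      intro j hj
      rw [hT, Finset.mem_filter] at hj
      obtain ⟨-, hji, hdist⟩ := hj
      rw [hxi] at hdist
      obtain ⟨v, hv, rfl, hjv⟩ := witness_of_lt j (lt_card_of_dist_le hub hdist)
      rw [hjv, dist_comm] at hdist
      have hvu : v ≠ u := by
        rintro rfl
        exact hji rfl
      have hd2 : dist (pos v) (pos u) ^ 2 ≤ 121 / 100 := by
        have h0 : 0 ≤ dist (pos v) (pos u) := dist_nonneg
        calc dist (pos v) (pos u) ^ 2 ≤ (11 / 10) ^ 2 := pow_le_pow_left₀ h0 hdist 2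
          _ = 121 / 100 := by norm_num
      obtain ⟨t, rfl⟩ := eq_nbr_of_dist_sq_le hvu hd2
      rw [hI, Finset.mem_image]
      exact ⟨t, Finset.mem_univ _, rfl⟩
    have h1 : 12 ≤ S.card := hIcard ▸ Finset.card_le_card hIS
    have h2 : T.card ≤ 12 := hIcard ▸ Finset.card_le_card hTI
    have h3 : S.card ≤ T.card := Finset.card_le_card hST
    exact ⟨by omega, by omega⟩

/-- **No interior box particle is `(1, 1/100)`-matched** (pair-sum obstruction of §2 with the defect
`(±1/25, 0, 0)` of `norm_pairSum_nbr`). -/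
theorem not_matched_witness {N : ℕ} {u : ℤ × ℤ × ℤ} (hu : u ∈ interiorIdx (side N)) :
    ¬ Matched 1 (1 / 100) (witness N) (idx N u (interiorIdx_subset _ hu)) := by
  have hub : u ∈ boxIdx (side N) := interiorIdx_subset _ hu
  have h4 := witness_idx N (nbr u 4) (nbr_mem_boxIdx hu 4)
  have h11 := witness_idx N (nbr u 11) (nbr_mem_boxIdx hu 11)
  have h0 := witness_idx N u hub
  refine not_matched_of_short_pairSum (j := idx N (nbr u 4) (nbr_mem_boxIdx hu 4))
    (k := idx N (nbr u 11) (nbr_mem_boxIdx hu 11)) ?_ ?_ ?_ ?_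
  · rw [h4, h0]; exact dist_nbr_le u 4
  · rw [h11, h0]; exact dist_nbr_le u 11
  · rw [h4, h11, h0, norm_pairSum_nbr]; norm_num
  · rw [h4, h11, h0, norm_pairSum_nbr]; norm_num

/-! ## §5 Counting and the limits -/

/-- The interior labels, as a type, inject into the Good particles. -/
theorem card_interior_le_card_good (N : ℕ) :
    (interiorIdx (side N)).card ≤ Nat.card {i : Fin N // Good (witness N) i} := by
  rw [← Nat.card_eq_finsetCard]
  refine Nat.card_le_card_of_injective
    (fun u : interiorIdx (side N) => (⟨idx N u.1 (interiorIdx_subset _ u.2), good_witness u.2⟩ :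
      {i : Fin N // Good (witness N) i})) ?_
  intro u v h
  simp only [Subtype.mk.injEq] at h
  exact Subtype.ext (idx_injective _ _ h)

/-- The interior labels, as a type, inject into the unmatched particles at `(R, ε) = (1, 1/100)`. -/
theorem card_interior_le_card_not_matched (N : ℕ) :
    (interiorIdx (side N)).card ≤ Nat.card {i : Fin N // ¬ Matched 1 (1 / 100) (witness N) i} := by
  rw [← Nat.card_eq_finsetCard]
  refine Nat.card_le_card_of_injective
    (fun u : interiorIdx (side N) => (⟨idx N u.1 (interiorIdx_subset _ u.2), not_matched_witness u.2⟩ :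
      {i : Fin N // ¬ Matched 1 (1 / 100) (witness N) i})) ?_
  intro u v h
  simp only [Subtype.mk.injEq] at h
  exact Subtype.ext (idx_injective _ _ h)

/-- Complementary count: bad = all − good. -/
theorem card_not_good_eq (N : ℕ) :
    (Nat.card {i : Fin N // ¬ Good (witness N) i} : ℝ) = N - Nat.card {i : Fin N // Good (witness N) i} := by
  classical
  rw [Nat.card_eq_fintype_card, Nat.card_eq_fintype_card, Fintype.card_subtype_compl, Nat.cast_sub,
    Fintype.card_fin]
  exact Fintype.card_subtype_le _

/-- Lower bound for the interior count: `#interior ≥ 2n³ − 10n²` (`n = side N ≥ 2`). -/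
theorem card_interior_ge {n : ℕ} (hn : 2 ≤ n) :
    (2 : ℝ) * n ^ 3 - 10 * n ^ 2 ≤ ((interiorIdx n).card : ℝ) := by
  rw [card_interiorIdx hn]
  have h1 : ((2 * n - 2 : ℕ) : ℝ) = 2 * n - 2 := by
    rw [Nat.cast_sub (by omega)]; push_cast; ring
  have h2 : ((n - 2 : ℕ) : ℝ) = n - 2 := by
    rw [Nat.cast_sub hn]; push_cast; ring
  push_cast [h1, h2]
  have hn' : (2 : ℝ) ≤ n := by exact_mod_cast hn
  nlinarith

/-- **The hypothesis of the crux holds for the witness**: the non-Good fraction tends to `0`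
(it is `O(N^{-1/3})`: only the box boundary and the spares are bad). -/
theorem tendsto_not_good_witness :
    Tendsto (fun N : ℕ => (Nat.card {i : Fin N // ¬ Good (witness N) i} : ℝ) / N) atTop (𝓝 0) := by
  have hbound : ∀ N : ℕ, 2 ≤ side N →
      (Nat.card {i : Fin N // ¬ Good (witness N) i} : ℝ) / N ≤ 13 / (side N : ℝ) := by
    intro N hn
    set n := side N with hndef
    have hN1 : (2 : ℝ) * n ^ 3 ≤ N := by exact_mod_cast two_mul_side_pow_le N
    have hN2 : (N : ℝ) < 2 * (n + 1) ^ 3 := by exact_mod_cast lt_two_mul_side_succ_pow N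
    have hn' : (2 : ℝ) ≤ n := by exact_mod_cast hn
    have hNpos : (0 : ℝ) < N := by nlinarith
    have hnpos : (0 : ℝ) < n := by linarith
    have hgood : (2 : ℝ) * n ^ 3 - 10 * n ^ 2 ≤ Nat.card {i : Fin N // Good (witness N) i} :=
      (card_interior_ge hn).trans (by exact_mod_cast card_interior_le_card_good N)
    rw [card_not_good_eq, div_le_div_iff₀ hNpos hnpos]
    nlinarith
  have hlim : Tendsto (fun N : ℕ => (13 : ℝ) / (side N : ℝ)) atTop (𝓝 0) :=
    tendsto_const_nhds.div_atTop (tendsto_natCast_atTop_atTop.comp side_tendsto_atTop)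
  have hev : ∀ᶠ N : ℕ in atTop, 2 ≤ side N := (side_tendsto_atTop.eventually (eventually_ge_atTop 2))
  refine squeeze_zero' (Eventually.of_forall fun N => by positivity) ?_ hlim
  filter_upwards [hev] with N hN using hbound N hN

/-- **The conclusion of the crux fails for the witness** at `(R, ε) = (1, 1/100)`: the unmatched fraction
is eventually `≥ 1/2` (indeed `→ 1`). -/
theorem not_tendsto_not_matched_witness :
    ¬ Tendsto (fun N : ℕ => (Nat.card {i : Fin N // ¬ Matched 1 (1 / 100) (witness N) i} : ℝ) / N)
      atTop (𝓝 0) := by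
  intro hT
  have hbound : ∀ N : ℕ, 20 ≤ side N →
      (1 : ℝ) / 2 ≤ (Nat.card {i : Fin N // ¬ Matched 1 (1 / 100) (witness N) i} : ℝ) / N := by
    intro N hn
    set n := side N with hndef
    have hN2 : (N : ℝ) < 2 * (n + 1) ^ 3 := by exact_mod_cast lt_two_mul_side_succ_pow N
    have hn' : (20 : ℝ) ≤ n := by exact_mod_cast hn
    have hN1 : (2 : ℝ) * n ^ 3 ≤ N := by exact_mod_cast two_mul_side_pow_le N
    have hNpos : (0 : ℝ) < N := by nlinarith
    have hbad : (2 : ℝ) * n ^ 3 - 10 * n ^ 2 ≤ Nat.card {i : Fin N // ¬ Matched 1 (1 / 100) (witness N) i} :=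
      (card_interior_ge (by omega)).trans (by exact_mod_cast card_interior_le_card_not_matched N)
    rw [le_div_iff₀ hNpos]
    nlinarith
  have hev : ∀ᶠ N : ℕ in atTop, 20 ≤ side N := side_tendsto_atTop.eventually (eventually_ge_atTop 20)
  have hsmall : ∀ᶠ N : ℕ in atTop,
      (Nat.card {i : Fin N // ¬ Matched 1 (1 / 100) (witness N) i} : ℝ) / N < 1 / 2 :=
    hT.eventually (gt_mem_nhds (by norm_num))
  obtain ⟨N, hN1, hN2⟩ := (hev.and hsmall).exists
  have := hbound N hN1
  linarith

/-! ## §6 Main negative result -/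

/-- **LOAD-BEARING ANALYSIS — the energy-free reading of `GapTwelveToBarlow` is FALSE.**
Deleting the hypothesis `∀ N, IsGroundState lennardJones (x N)` from the crux (keeping the gap-twelve
hypothesis verbatim) gives a false statement: the witness sequence `witness` (fcc with (100) gaps alternating
`7/10, 33/50`; every bulk site has exactly twelve neighbours at distances `1, √0.99, √0.9356 ∈ [55/57, 1]`,
nothing in `(1, 11/10]`, everything `55/57`-separated) has non-Good fraction `→ 0`, yet at
`(R, ε) = (1, 1/100)` NO bulk site is matched to any `barlowStacking a h s` (`a, h > 1/2`, any `s, z, A`),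
because its up/down neighbour offsets sum to `(±1/25, 0, 0)` while Barlow windows are centrosymmetric modulo
`Λ*(a) ⊕ hℤe₃` (min norm `> 1/(2√3)`) to precision `2ε = 1/50 < 1/25`.  Hence ANY proof of the crux must use
minimality, and must use it to kill strain at the level of SINGLE bonds (`R = 1`), not only mesoscopic
strain gradients: the conclusion's template tolerates no bond-length/gap alternation above `2ε`, while the
hypothesis tolerates `3.5 %`. -/
theorem gapTwelveToBarlow_false_without_isGroundState : ¬ GapTwelveToBarlowWithoutIsGroundState := by
  intro hW
  exact not_tendsto_not_matched_witness
    (hW witness tendsto_not_good_witness 1 (1 / 100) one_pos (by norm_num) (by norm_num))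

/-! ## §7 The difference lattice for integer combinations (landed as `Negative.FiveFoldShell`) -/

/-- `v` lies in the difference lattice `Λ*(a) ⊕ hℤe₃` of the Barlow templates with parameters `a, h`:
coordinates `(a P/2, a√3 Q/6, K h)` with integers `P ≡ Q (mod 2)`, `K`. -/
def InDiffLattice (a h : ℝ) (v : EuclideanSpace ℝ (Fin 3)) : Prop :=
  ∃ P Q K : ℤ, Even (P - Q) ∧ v 0 = a / 2 * P ∧ v 1 = a * √3 / 6 * Q ∧ v 2 = K * h

/-- `0` is in the difference lattice. -/
theorem inDiffLattice_zero (a h : ℝ) : InDiffLattice a h 0 :=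
  ⟨0, 0, 0, by simp, by simp, by simp, by simp⟩

/-- The difference lattice is closed under addition. -/
theorem InDiffLattice.add {a h : ℝ} {v w : EuclideanSpace ℝ (Fin 3)} (hv : InDiffLattice a h v)
    (hw : InDiffLattice a h w) : InDiffLattice a h (v + w) := by
  obtain ⟨P, Q, K, hpar, h0, h1, h2⟩ := hv
  obtain ⟨P', Q', K', hpar', h0', h1', h2'⟩ := hw
  refine ⟨P + P', Q + Q', K + K', ?_, ?_, ?_, ?_⟩
  · have : P + P' - (Q + Q') = (P - Q) + (P' - Q') := by ring
    rw [this]; exact hpar.add hpar'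
  · rw [PiLp.add_apply, h0, h0']; push_cast; ring
  · rw [PiLp.add_apply, h1, h1']; push_cast; ring
  · rw [PiLp.add_apply, h2, h2']; push_cast; ring

/-- The difference lattice is closed under integer multiples. -/
theorem InDiffLattice.zsmul {a h : ℝ} {v : EuclideanSpace ℝ (Fin 3)} (c : ℤ) (hv : InDiffLattice a h v) :
    InDiffLattice a h ((c : ℝ) • v) := by
  obtain ⟨P, Q, K, hpar, h0, h1, h2⟩ := hv
  refine ⟨c * P, c * Q, c * K, ?_, ?_, ?_, ?_⟩
  · have : c * P - c * Q = c * (P - Q) := by ring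
    rw [this]; exact hpar.mul_left c
  · rw [PiLp.smul_apply, smul_eq_mul, h0]; push_cast; ring
  · rw [PiLp.smul_apply, smul_eq_mul, h1]; push_cast; ring
  · rw [PiLp.smul_apply, smul_eq_mul, h2]; push_cast; ring

/-- Differences of template points lie in the difference lattice. [folklore] -/
theorem inDiffLattice_barlowPos_sub (a h : ℝ) (s : ℤ → ℤ) (k i j k' i' j' : ℤ) :
    InDiffLattice a h (barlowPos a h s k i j - barlowPos a h s k' i' j') := by
  refine ⟨2 * (i - i') + (j - j') + (haggLabel s k - haggLabel s k'),
    3 * (j - j') + (haggLabel s k - haggLabel s k'), k - k', ?_, ?_, ?_, ?_⟩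
  · exact ⟨(i - i') - (j - j'), by ring⟩
  · simp only [PiLp.sub_apply, barlowPos_apply_zero]; push_cast; ring
  · simp only [PiLp.sub_apply, barlowPos_apply_one]; push_cast; ring
  · simp only [PiLp.sub_apply, barlowPos_apply_two]; push_cast; ring

/-- **Dichotomy**: a difference-lattice vector is `0` or has squared norm `≥ min (a²/3) h²`. [folklore] -/
theorem InDiffLattice.dichotomy {a h : ℝ} {v : EuclideanSpace ℝ (Fin 3)} (hv : InDiffLattice a h v) :
    v = 0 ∨ min (a ^ 2 / 3) (h ^ 2) ≤ ‖v‖ ^ 2 := by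
  obtain ⟨P, Q, K, hpar, h0, h1, h2⟩ := hv
  have h3 : (√3 : ℝ) ^ 2 = 3 := Real.sq_sqrt (by norm_num)
  have hnorm : ‖v‖ ^ 2 = a ^ 2 / 12 * (3 * (P : ℝ) ^ 2 + (Q : ℝ) ^ 2) + (K : ℝ) ^ 2 * h ^ 2 := by
    rw [EuclideanSpace.norm_eq, Real.sq_sqrt (Finset.sum_nonneg fun _ _ => by positivity),
      Fin.sum_univ_three, Real.norm_eq_abs, Real.norm_eq_abs, Real.norm_eq_abs, sq_abs, sq_abs, sq_abs,
      h0, h1, h2]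
    linear_combination (a ^ 2 / 36 * (Q : ℝ) ^ 2) * h3
  by_cases hK0 : K = 0
  · by_cases hPQ : P = 0 ∧ Q = 0
    · left
      ext l
      fin_cases l
      · simpa [hPQ.1] using h0
      · simpa [hPQ.2] using h1
      · simpa [hK0] using h2
    · right
      have h4 : (4 : ℝ) ≤ 3 * (P : ℝ) ^ 2 + (Q : ℝ) ^ 2 := by exact_mod_cast four_le_of_parity hpar hPQ
      calc min (a ^ 2 / 3) (h ^ 2) ≤ a ^ 2 / 3 := min_le_left _ _
        _ ≤ a ^ 2 / 12 * (3 * (P : ℝ) ^ 2 + (Q : ℝ) ^ 2) + (K : ℝ) ^ 2 * h ^ 2 := by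
            nlinarith [sq_nonneg a, sq_nonneg ((K : ℝ) * h)]
        _ = ‖v‖ ^ 2 := hnorm.symm
  · right
    have hK1 : (1 : ℝ) ≤ (K : ℝ) ^ 2 := by
      exact_mod_cast (one_le_sq_iff_one_le_abs _).2 (Int.one_le_abs hK0)
    calc min (a ^ 2 / 3) (h ^ 2) ≤ h ^ 2 := min_le_right _ _
      _ ≤ a ^ 2 / 12 * (3 * (P : ℝ) ^ 2 + (Q : ℝ) ^ 2) + (K : ℝ) ^ 2 * h ^ 2 := by
          nlinarith [sq_nonneg a, sq_nonneg h, sq_nonneg (P : ℝ), sq_nonneg (Q : ℝ)]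
      _ = ‖v‖ ^ 2 := hnorm.symm

/-- Integer combinations of differences `p t − z` of template points lie in the difference lattice. -/
theorem inDiffLattice_sum {a h : ℝ} {s : ℤ → ℤ} {m : ℕ} (c : Fin m → ℤ)
    (p : Fin m → EuclideanSpace ℝ (Fin 3)) (z : EuclideanSpace ℝ (Fin 3))
    (hp : ∀ t, p t ∈ barlowStacking a h s) (hz : z ∈ barlowStacking a h s) :
    InDiffLattice a h (∑ t, (c t : ℝ) • (p t - z)) := by
  obtain ⟨k₀, i₀, j₀, rfl⟩ := hz
  induction (Finset.univ : Finset (Fin m)) using Finset.induction_on with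
  | empty => simpa using inDiffLattice_zero a h
  | insert t S htS ih =>
    rw [Finset.sum_insert htS]
    refine InDiffLattice.add (InDiffLattice.zsmul (c t) ?_) ih
    obtain ⟨k, i, j, hk⟩ := hp t
    rw [hk]
    exact inDiffLattice_barlowPos_sub a h s k i j k₀ i₀ j₀

/-- **Combination obstruction.**  If site `i` has `R`-neighbours `j t` (`t : Fin m`) and integer
coefficients `c t` such that `w := ∑ c t • (x (j t) − x i)` satisfies `(∑ |c t|) ε < ‖w‖` and
`(‖w‖ + (∑ |c t|) ε)² < 1/12`, then `i` is `(R, ε)`-matched to NO Barlow template (`a, h > 1/2`; any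
`s, z, A`): the matched template points would combine to a difference-lattice vector of norm in
`(0, 1/(2√3))`. [folklore] -/
theorem not_matched_of_short_combination {N m : ℕ} {x : Fin N → EuclideanSpace ℝ (Fin 3)} {i : Fin N}
    (j : Fin m → Fin N) (c : Fin m → ℤ) {R ε : ℝ} (hjR : ∀ t, dist (x (j t)) (x i) ≤ R)
    (hlow : (∑ t, |(c t : ℝ)|) * ε < ‖∑ t, (c t : ℝ) • (x (j t) - x i)‖)
    (hup : (‖∑ t, (c t : ℝ) • (x (j t) - x i)‖ + (∑ t, |(c t : ℝ)|) * ε) ^ 2 < 1 / 12) :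
    ¬ Matched R ε x i := by
  rintro ⟨a, h, ha, -, hh, -, s, -, z, hz, A, -, h2⟩
  choose p hp hpx using fun t => h2 (j t) (hjR t)
  set w := ∑ t, (c t : ℝ) • (x (j t) - x i) with hw
  set v := ∑ t, (c t : ℝ) • (p t - z) with hv
  have hvL : InDiffLattice a h v := inDiffLattice_sum c p z hp hz
  -- `‖w − A v‖ ≤ (∑ |c|) ε`
  have hAv : A v = ∑ t, (c t : ℝ) • A (p t - z) := by
    rw [hv, map_sum]; simp only [map_smul]
  have htri : ‖w - A v‖ ≤ (∑ t, |(c t : ℝ)|) * ε := by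
    have hdiff : w - A v = ∑ t, (c t : ℝ) • ((x (j t) - x i) - A (p t - z)) := by
      rw [hw, hAv, ← Finset.sum_sub_distrib]
      refine Finset.sum_congr rfl fun t _ => ?_
      exact (smul_sub _ _ _).symm
    rw [hdiff, Finset.sum_mul]
    refine (norm_sum_le _ _).trans (Finset.sum_le_sum fun t _ => ?_)
    rw [norm_smul, Real.norm_eq_abs]
    refine mul_le_mul_of_nonneg_left ?_ (abs_nonneg _)
    have := hpx t
    rw [dist_eq_norm] at this
    have e1 : x (j t) - (x i + A (p t - z)) = (x (j t) - x i) - A (p t - z) := by abel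
    rwa [e1] at this
  have hnAv : ‖A v‖ = ‖v‖ := A.norm_map _
  have hlow' : ‖w‖ - (∑ t, |(c t : ℝ)|) * ε ≤ ‖v‖ := by
    have := norm_sub_norm_le w (A v); linarith
  have hup' : ‖v‖ ≤ ‖w‖ + (∑ t, |(c t : ℝ)|) * ε := by
    have := norm_sub_norm_le (A v) w
    rw [norm_sub_rev] at this; linarith
  rcases hvL.dichotomy with h0 | hmin
  · rw [h0, norm_zero] at hlow'; linarith
  · have hmin' : (1 : ℝ) / 12 < min (a ^ 2 / 3) (h ^ 2) := by
      rw [lt_min_iff]; constructor <;> nlinarith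
    have hnn : 0 ≤ ‖v‖ := norm_nonneg _
    have hsq : ‖v‖ ^ 2 ≤ (‖w‖ + (∑ t, |(c t : ℝ)|) * ε) ^ 2 := pow_le_pow_left₀ hnn hup' 2
    linarith

/-! ## §8 The decahedral-axis (`D₅ₕ`) cluster: Good yet unmatched, pointwise -/

/-- Integer coordinates (units of `1/1005`) of the thirteen-point decahedral-axis cluster: `0` the centre,
`1, 2` the poles, `3 … 7` the upper ring (`k = 0, …, 4` at azimuth `72 k°`), `8 … 12` the lower ring
(aligned with the upper one). -/
def decaInt : Fin 13 → Fin 3 → ℤ :=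
  ![![0, 0, 0], ![0, 0, 1005], ![0, 0, -1005],
    ![856, 0, 503], ![265, 814, 503], ![-693, 503, 503], ![-693, -503, 503], ![265, -814, 503],
    ![856, 0, -503], ![265, 814, -503], ![-693, 503, -503], ![-693, -503, -503], ![265, -814, -503]]

/-- The cluster in `ℝ³`. -/
def deca : Fin 13 → EuclideanSpace ℝ (Fin 3) := fun n => (1005 : ℝ)⁻¹ • intVec (decaInt n)

/-- Integer certificate: every point is within `1005` of the centre, every pair of distinct points is
`≥ √980000 > 1005·55/57` apart. -/
theorem decaInt_cert :
    (∀ n : Fin 13, sqNormInt (decaInt n - decaInt 0) ≤ 1005 ^ 2) ∧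
    (∀ n n' : Fin 13, n ≠ n' → 980000 ≤ sqNormInt (decaInt n - decaInt n')) := by
  refine ⟨by decide, by decide⟩

/-- Distances in the cluster from the integer certificate. -/
theorem dist_deca (n n' : Fin 13) :
    dist (deca n) (deca n') = (1005 : ℝ)⁻¹ * Real.sqrt (sqNormInt (decaInt n - decaInt n') : ℝ) := by
  rw [dist_eq_norm, deca, deca, ← smul_sub, intVec_sub, norm_smul, norm_inv, Real.norm_of_nonneg
    (by norm_num), norm_intVec]

/-- Every point is within distance `1` of the centre. -/
theorem dist_deca_zero_le (n : Fin 13) : dist (deca 0) (deca n) ≤ 1 := by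
  rw [dist_comm, dist_deca]
  have h1 : (sqNormInt (decaInt n - decaInt 0) : ℝ) ≤ (1005 : ℝ) ^ 2 := by
    exact_mod_cast decaInt_cert.1 n
  have h2 : Real.sqrt (sqNormInt (decaInt n - decaInt 0) : ℝ) ≤ 1005 := by
    calc Real.sqrt (sqNormInt (decaInt n - decaInt 0) : ℝ) ≤ Real.sqrt ((1005 : ℝ) ^ 2) :=
          Real.sqrt_le_sqrt h1
      _ = 1005 := Real.sqrt_sq (by norm_num)
  have := mul_le_mul_of_nonneg_left h2 (by norm_num : (0 : ℝ) ≤ (1005 : ℝ)⁻¹)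
  linarith [this]

/-- Distinct points are `≥ 55/57` apart. -/
theorem le_dist_deca {n n' : Fin 13} (h : n ≠ n') : (55 : ℝ) / 57 ≤ dist (deca n) (deca n') := by
  rw [dist_deca]
  have h1 : (980000 : ℝ) ≤ (sqNormInt (decaInt n - decaInt n') : ℝ) := by
    exact_mod_cast decaInt_cert.2 n n' h
  have h2 : (985 : ℝ) ≤ Real.sqrt (sqNormInt (decaInt n - decaInt n') : ℝ) := by
    rw [Real.le_sqrt (by norm_num) (by linarith)]; linarith
  have := mul_le_mul_of_nonneg_left h2 (by norm_num : (0 : ℝ) ≤ (1005 : ℝ)⁻¹)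
  linarith [this, show (55 : ℝ) / 57 ≤ (1005 : ℝ)⁻¹ * 985 by norm_num]

/-- **The centre of the `D₅ₕ` cluster is Good** for the crux's hypothesis predicate (exactly twelve within
`1`, nothing else at all, every pair `≥ 55/57`). -/
theorem good_deca : Good deca 0 := by
  classical
  refine ⟨?_, ?_, ?_⟩
  · intro n _ n' hn'
    exact le_dist_deca (Ne.symm hn')
  · have : (Finset.univ.filter fun n : Fin 13 => n ≠ 0 ∧ dist (deca 0) (deca n) ≤ 1) =
        Finset.univ.filter fun n : Fin 13 => n ≠ 0 := by
      ext n
      simp only [Finset.mem_filter, Finset.mem_univ, true_and, and_iff_left_iff_imp]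
      exact fun _ => dist_deca_zero_le n
    rw [this]
    decide
  · calc (Finset.univ.filter fun n : Fin 13 => n ≠ 0 ∧ dist (deca 0) (deca n) ≤ 11 / 10).card
        ≤ (Finset.univ.filter fun n : Fin 13 => n ≠ 0).card :=
          Finset.card_le_card (fun n hn => by
            simp only [Finset.mem_filter, Finset.mem_univ, true_and] at hn ⊢; exact hn.1)
      _ = 12 := by decide

/-- The six ring neighbours used by the golden-ratio combination: `u₀, ℓ₀, u₁, ℓ₁, u₄, ℓ₄`. -/
def ringIdx : Fin 6 → Fin 13 := ![3, 8, 4, 9, 7, 12]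

/-- Their coefficients `−3, −3, 5, 5, 5, 5` (`5/3 ≈ φ`: `−3·2·856 + 5·4·265 = 164` in units of `1/1005`). -/
def ringCoeff : Fin 6 → ℤ := ![-3, -3, 5, 5, 5, 5]

/-- `intVec` as an additive monoid homomorphism. -/
def intVecHom : (Fin 3 → ℤ) →+ EuclideanSpace ℝ (Fin 3) where
  toFun := intVec
  map_zero' := by ext l; simp [intVec]
  map_add' v w := by ext l; simp [intVec]

/-- `intVec` commutes with finite sums. -/
theorem intVec_sum {ι : Type*} (S : Finset ι) (g : ι → Fin 3 → ℤ) :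
    intVec (∑ t ∈ S, g t) = ∑ t ∈ S, intVec (g t) :=
  map_sum intVecHom g S

/-- The integer combination behind the golden-ratio defect: `−3·(u₀ + ℓ₀) + 5·(u₁ + ℓ₁ + u₄ + ℓ₄) = (164, 0, 0)`. -/
theorem sum_ringCoeff_int : ∑ t, ringCoeff t • (decaInt (ringIdx t) - decaInt 0) = ![164, 0, 0] := by
  decide

/-- The golden-ratio combination of the ring offsets is the short vector `(164/1005, 0, 0)`. -/
theorem sum_ringCoeff_smul :
    ∑ t, (ringCoeff t : ℝ) • (deca (ringIdx t) - deca 0) = (1005 : ℝ)⁻¹ • intVec ![164, 0, 0] := by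
  have h1 : ∀ t, (ringCoeff t : ℝ) • (deca (ringIdx t) - deca 0) =
      (1005 : ℝ)⁻¹ • intVec (ringCoeff t • (decaInt (ringIdx t) - decaInt 0)) := by
    intro t
    rw [deca, deca, ← smul_sub, intVec_sub, smul_comm, intVec_zsmul]
  rw [Finset.sum_congr rfl (fun t _ => h1 t), ← Finset.smul_sum, ← intVec_sum, sum_ringCoeff_int]

/-- Its norm is `164/1005`. -/
theorem norm_sum_ringCoeff_smul : ‖∑ t, (ringCoeff t : ℝ) • (deca (ringIdx t) - deca 0)‖ = 164 / 1005 := by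
  rw [sum_ringCoeff_smul, norm_smul, norm_inv, Real.norm_of_nonneg (by norm_num), norm_intVec]
  have hint : sqNormInt ![164, 0, 0] = 164 ^ 2 := by decide
  have : (sqNormInt ![164, 0, 0] : ℝ) = (164 : ℝ) ^ 2 := by exact_mod_cast hint
  rw [this, Real.sqrt_sq (by norm_num)]
  norm_num

/-- The total coefficient weight is `26`. -/
theorem sum_abs_ringCoeff : ∑ t, |(ringCoeff t : ℝ)| = 26 := by
  have hint : ∑ t, |ringCoeff t| = 26 := by decide
  exact_mod_cast hint

/-- **The centre of the `D₅ₕ` cluster is not `(1, 1/500)`-matched** to any Barlow template: the golden-ratio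
combination has norm `164/1005 ≈ 0.163 ∈ (26/500, 1/(2√3) − 26/500)`. -/
theorem not_matched_deca : ¬ Matched 1 (1 / 500) deca 0 := by
  refine not_matched_of_short_combination ringIdx ringCoeff (fun t => ?_) ?_ ?_
  · rw [dist_comm]; exact dist_deca_zero_le _
  · rw [norm_sum_ringCoeff_smul, sum_abs_ringCoeff]; norm_num
  · rw [norm_sum_ringCoeff_smul, sum_abs_ringCoeff]; norm_num

/-- **Gap-twelve does not imply Barlow, pointwise**: there is a finite configuration with a site that is
Good (exactly twelve neighbours at distances in `[55/57, 1]`, all pairs `55/57`-separated, nothing in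
`(1, 11/10]`) and NOT `(1, ε)`-matched for any `ε ≤ 1/500`.  K3 is therefore an essentially GLOBAL /
energetic statement: the implication must come from the neighbours' shells (a.e. Good) and minimality. -/
theorem exists_good_not_matched {ε : ℝ} (hε : 0 < ε) (hε' : ε ≤ 1 / 500) :
    ∃ (N : ℕ) (x : Fin N → EuclideanSpace ℝ (Fin 3)) (i : Fin N), Good x i ∧ ¬ Matched 1 ε x i := by
  refine ⟨13, deca, 0, good_deca, ?_⟩
  refine not_matched_of_short_combination ringIdx ringCoeff (fun t => ?_) ?_ ?_
  · rw [dist_comm]; exact dist_deca_zero_le _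
  · rw [norm_sum_ringCoeff_smul, sum_abs_ringCoeff]; nlinarith
  · rw [norm_sum_ringCoeff_smul, sum_abs_ringCoeff]; nlinarith

end Summit.AtomisticToContinuum.Crystallization.Cruxes.GapTwelveToBarlow.Disproof
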